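import Summits.ABC.ABC.Theses.FeketeScales
import Literature.NumberTheory.DiophantineGeometry.AbcPrimePowerFamily
import HarnessLib

/-!
# Route FeketeScales — crux `SparseGoodScales` (stmt-ABC-2161): the held stub DA∃ excludes every
# INTERMEDIATE growth law for the radical of `q^n − 1` (a standalone floor for line `SketchIdeator4`)

Helper file (`--supports stmt-ABC-2161`, lead seat c11) for the crux `SparseGoodScales` of route
`FeketeScales`.  The horizontal stub of the picked line `SketchIdeator4` is DA∃
(`stub_droughtsOfSomeRatio`): for every `δ > 0` there is SOME ratio `Λ > 1` such that arbitrarily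
large scales `R` carry no abc triple with `rad ≤ R < rad^Λ` and `c > rad^{1+δ}`.  Twelve lead seats
recorded it as "engine-less standalone, no floor claimed": the Wieferich-level floors of the crux
(p99695) and of the windowed residue WGS (`FeketeScalesSparseGoodScalesWindowedFloor.lean`) control the
spoiling radicals `rad(q^n − 1)` from one side, or from two sides with different exponents, which a
drought statement with an uncontrolled ratio `Λ` escapes.

What DOES NOT escape is a two-sided control with the SAME exponent.  Call `γ ∈ (0,1)` an
intermediate growth rate of the radical of `q^n − 1` if `rad(q^n − 1) = q^{(γ + o(1)) n}`, i.e.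
`∀ ε > 0 ∃ n₀ ∀ n ≥ n₀, q^{(γ−ε)n} ≤ rad(q^n − 1) ≤ q^{(γ+ε)n}`.  Under such a law the triples
`(1, q^n − 1, q^n)` have quality `→ 1/γ > 1` AND radicals `q^{(γ+o(1))n}` dense in EVERY ratio
`Λ > 1`, so they spoil every window at every large scale:

* `sparseGoodScales_droughts_false_of_radical_rate` — an intermediate growth rate at one prime `q`
  refutes DA∃ (already DA at the single exponent `δ = (1−γ)/2`, whatever the ratio);
* `sparseGoodScales_droughts_imp_no_intermediate_radical_rate` — hence **DA∃ ⟹ for every prime `q`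
  and every `γ ∈ (0,1)`, `rad(q^n − 1)` is NOT `q^{(γ+o(1))n}`** (registered sub-goal, hypothesis =
  the registered signature of `stub_droughtsOfSomeRatio` verbatim).

Reading.  abc gives `rad(q^n − 1) = q^{(1+o(1))n}` (rate `1`); unconditionally only
`log rad(q^n − 1) ≥ (1 + o(1)) log n`-type bounds are known (Stewart 2013 for the largest prime
factor), so NO rate `γ ∈ (0,1)` is excluded today: excluding `γ` needs `rad(q^n − 1) ≥ q^{(γ+ε)n}`
for infinitely many `n` (open for every `γ + ε > 0`, already "`2^n − 1` is not exponentially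
powerful infinitely often") or `rad(q^n − 1) ≤ q^{(γ−ε)n}` infinitely often (not expected).  So the
held stub DA∃ — and with it WGS, the crux, and every line through them — is, standalone, at least as
hard as ruling out one intermediate growth law for the radical of `2^n − 1`: an open problem of
abc type, weaker than the non-Wieferich floors above it but a floor nonetheless.  In-route DA∃ stays
abc-equivalent given the vertical stub (`FeketeScalesSparseGoodScalesMinimalResidue.lean`, p111037).
-/

-- `Summit.<Summit>.<Problem>` is the mandated summit-side namespace (CONVENTIONS §2); for the
-- single-conjunct summit `ABC` the two coincide, so the duplicate `ABC.ABC` is deliberate.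
set_option linter.dupNamespace false

noncomputable section

namespace Summit.ABC.ABC.Theorems

open Literature.NumberTheory.DiophantineGeometry UniqueFactorizationMonoid
open Summit.ABC.ABC.Theses.FeketeScales

/-- **An intermediate growth rate of `rad(q^n − 1)` refutes drought scales at `δ = (1−γ)/2` for
EVERY ratio `Λ > 1`.**  If `q` is prime, `0 < γ < 1`, and `q^{(γ−ε)n} ≤ rad(q^n − 1) ≤ q^{(γ+ε)n}`
for every `ε > 0` and all large `n`, then for every `Λ > 1` only boundedly many scales `R` can have
the drought property "every abc triple with `rad ≤ R < rad^Λ` has `c ≤ rad^{1+δ}`", `δ = (1−γ)/2`.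
Proof: given `Λ`, take `ε ≤ (1−γ)/8` with `ε(Λ+1) < γ(Λ−1)`; at a large scale `R = q^x` put
`n = ⌊(x−1)/(γ+ε)⌋`: the triple `(1, q^n − 1, q^n)` has `rad = q·rad(q^n − 1) ≤ q^{(γ+ε)n+1} ≤ R`,
`rad^Λ ≥ q^{Λ((γ−ε)n+1)} > q^x = R` (as `Λ(γ−ε) > γ+ε` and `n` is large), and
`rad^{1+δ} ≤ q^{(1+δ)((γ+ε)n+1)} < q^n = c` (as `(1+δ)(γ+ε) ≤ 1 − 3(1−γ)/8`). [folklore] -/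
theorem sparseGoodScales_droughts_false_of_radical_rate {q : ℕ} (hq : q.Prime) {γ : ℝ}
    (hγ0 : 0 < γ) (hγ1 : γ < 1)
    (hH : ∀ ε : ℝ, 0 < ε → ∃ n₀ : ℕ, ∀ n : ℕ, n₀ ≤ n →
      (q : ℝ) ^ ((γ - ε) * n) ≤ ((radical (q ^ n - 1) : ℕ) : ℝ) ∧
        ((radical (q ^ n - 1) : ℕ) : ℝ) ≤ (q : ℝ) ^ ((γ + ε) * n))
    {Λ : ℝ} (hΛ : 1 < Λ)
    (hdr : ∀ N : ℕ, ∃ R : ℕ, N ≤ R ∧ ∀ a b c : ℕ, IsABCTriple a b c → rad a b c ≤ R →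
      (R : ℝ) < ((rad a b c : ℕ) : ℝ) ^ Λ → (c : ℝ) ≤ ((rad a b c : ℕ) : ℝ) ^ (1 + (1 - γ) / 2)) :
    False := by
  -- parameters
  set δ : ℝ := (1 - γ) / 2 with hδ
  set u : ℝ := 1 - γ with hu
  have hu0 : 0 < u := by rw [hu]; linarith
  have hu1 : u < 1 := by rw [hu]; linarith
  set ε₁ : ℝ := (1 - γ) / 8 with hε₁
  have hε₁0 : 0 < ε₁ := by rw [hε₁]; linarith
  have hΛ0 : 0 < Λ := by linarith
  set ε : ℝ := min ε₁ (γ * (Λ - 1) / (2 * (Λ + 1))) with hε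
  have hεpos' : 0 < γ * (Λ - 1) / (2 * (Λ + 1)) := by
    apply div_pos (mul_pos hγ0 (by linarith)) (by linarith)
  have hε0 : 0 < ε := lt_min hε₁0 hεpos'
  have hεε₁ : ε ≤ ε₁ := min_le_left _ _
  have hεΛ' : ε ≤ γ * (Λ - 1) / (2 * (Λ + 1)) := min_le_right _ _
  -- `ε (Λ + 1) < γ (Λ − 1)` and `ε < γ / 2`
  have hεΛ : ε * (Λ + 1) < γ * (Λ - 1) := by
    have h1 : ε * (Λ + 1) ≤ γ * (Λ - 1) / (2 * (Λ + 1)) * (Λ + 1) :=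
      mul_le_mul_of_nonneg_right hεΛ' (by linarith)
    have h2 : γ * (Λ - 1) / (2 * (Λ + 1)) * (Λ + 1) = γ * (Λ - 1) / 2 := by
      field_simp
    have h3 : 0 < γ * (Λ - 1) := mul_pos hγ0 (by linarith)
    linarith
  have hεγ : ε < γ / 2 := by
    have h1 : γ * (Λ - 1) / (2 * (Λ + 1)) < γ / 2 := by
      rw [div_lt_iff₀ (by linarith : (0 : ℝ) < 2 * (Λ + 1))]
      linarith
    linarith
  set cp : ℝ := γ + ε with hcp
  set cm : ℝ := γ - ε with hcm
  have hcp0 : 0 < cp := by rw [hcp]; linarith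
  have hcp1 : cp < 1 := by rw [hcp, hε₁] at *; linarith
  have hcm0 : 0 < cm := by rw [hcm]; linarith
  have hcpε₁ : cp ≤ γ + ε₁ := by rw [hcp]; linarith
  -- the window slack `A = Λ cm − cp > 0`
  have hA : 0 < Λ * cm - cp := by rw [hcm, hcp]; linarith
  -- thresholds on `n`
  obtain ⟨n₀, hn₀⟩ := hH ε hε0
  obtain ⟨n₁, hn₁⟩ := exists_nat_gt (4 / u)
  obtain ⟨n₂, hn₂⟩ := exists_nat_gt ((cp + 1) / (Λ * cm - cp))
  set nt : ℕ := max (max n₀ n₁) (max n₂ 1) with hnt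
  -- threshold on the scale: `x ≥ X₀ := 1 + cp (nt + 1)`
  set X₀ : ℝ := 1 + cp * (nt + 1) with hX₀
  have hq1 : (1 : ℝ) < q := by exact_mod_cast hq.one_lt
  have hq0 : (0 : ℝ) < q := by linarith
  obtain ⟨N₁, hN₁⟩ := exists_nat_gt ((q : ℝ) ^ X₀)
  obtain ⟨R, hRN, hgood⟩ := hdr N₁
  -- `R = q^x`, `x ≥ X₀`
  have hR0 : (0 : ℝ) < R := by
    have : (q : ℝ) ^ X₀ < R := lt_of_lt_of_le hN₁ (by exact_mod_cast hRN)
    exact lt_trans (Real.rpow_pos_of_pos hq0 _) this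
  set x : ℝ := Real.logb q R with hx
  have hqx : (q : ℝ) ^ x = R := by rw [hx]; exact Real.rpow_logb hq0 hq1.ne' hR0
  have hxX : X₀ ≤ x := by
    rw [hx, Real.le_logb_iff_rpow_le hq1 hR0]
    exact le_of_lt (lt_of_lt_of_le hN₁ (by exact_mod_cast hRN))
  have hX1 : 1 ≤ X₀ := by
    rw [hX₀]
    have : (0 : ℝ) ≤ cp * (nt + 1) := mul_nonneg hcp0.le (by positivity)
    linarith
  -- `n := ⌊(x − 1)/cp⌋`
  have hy0 : 0 ≤ (x - 1) / cp := div_nonneg (by linarith) hcp0.le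
  set n : ℕ := ⌊(x - 1) / cp⌋₊ with hn
  have hn_le : (n : ℝ) ≤ (x - 1) / cp := Nat.floor_le hy0
  have hn_gt : (x - 1) / cp < n + 1 := Nat.lt_floor_add_one _
  have hnt1 : nt + 1 ≤ n := by
    rw [hn]
    apply Nat.le_floor
    push_cast
    rw [le_div_iff₀ hcp0]
    have : X₀ - 1 = cp * (nt + 1) := by rw [hX₀]; ring
    linarith
  have hn0' : n₀ ≤ n := by omega
  have hn1' : n₁ ≤ n := by omega
  have hn2' : n₂ ≤ n := by omega
  have hnone : 1 ≤ n := by omega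
  have hnR : (0 : ℝ) ≤ n := by positivity
  -- two-sided radical bounds at `n`
  obtain ⟨hlow, hupp⟩ := hn₀ n hn0'
  set r : ℝ := ((radical (q ^ n - 1) : ℕ) : ℝ) with hr
  have hr0 : 0 < r := by
    rw [hr]; exact_mod_cast Nat.radical_pos _
  -- the triple `(1, q^n − 1, q^n)` and its radical `r · q`
  have htri : IsABCTriple 1 (q ^ n - 1) (q ^ n) := isABCTriple_one_pow_sub_one hq.two_le hnone
  have hradT : ((rad 1 (q ^ n - 1) (q ^ n) : ℕ) : ℝ) = r * q := by
    rw [rad_one_pow_sub_one_pow hq hnone, hr]; push_cast; ring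
  -- upper: `rad ≤ q^{cp n + 1} ≤ q^x = R`
  have hup1 : r * q ≤ (q : ℝ) ^ (cp * n + 1) := by
    rw [Real.rpow_add hq0, Real.rpow_one]
    exact mul_le_mul_of_nonneg_right hupp hq0.le
  have hcpn : cp * n + 1 ≤ x := by
    have := mul_le_mul_of_nonneg_left hn_le hcp0.le
    rw [mul_div_cancel₀ _ hcp0.ne'] at this
    linarith
  have hradR : ((rad 1 (q ^ n - 1) (q ^ n) : ℕ) : ℝ) ≤ (R : ℝ) := by
    rw [hradT, ← hqx]
    exact le_trans hup1 (Real.rpow_le_rpow_of_exponent_le hq1.le hcpn)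
  have hradRn : rad 1 (q ^ n - 1) (q ^ n) ≤ R := by exact_mod_cast hradR
  -- window: `R < rad^Λ`, from `rad ≥ q^{cm n + 1}` and `Λ (cm n + 1) > x`
  have hlow1 : (q : ℝ) ^ (cm * n + 1) ≤ r * q := by
    rw [Real.rpow_add hq0, Real.rpow_one]
    exact mul_le_mul_of_nonneg_right hlow hq0.le
  have hexp : x < Λ * (cm * n + 1) := by
    -- `x < cp (n + 1) + 1` and `(Λ cm − cp) n > cp + 1`
    have h1 : x - 1 < cp * (n + 1) := by
      have := (div_lt_iff₀ hcp0).mp hn_gt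
      linarith
    have h2 : (cp + 1) / (Λ * cm - cp) < n := lt_of_lt_of_le hn₂ (by exact_mod_cast hn2')
    have h3 : cp + 1 < (Λ * cm - cp) * n := by
      rw [div_lt_iff₀ hA] at h2; linarith
    linarith
  have hwin : (R : ℝ) < ((rad 1 (q ^ n - 1) (q ^ n) : ℕ) : ℝ) ^ Λ := by
    have hpos : (0 : ℝ) < (q : ℝ) ^ (cm * n + 1) := Real.rpow_pos_of_pos hq0 _
    calc (R : ℝ) = (q : ℝ) ^ x := hqx.symm
      _ < (q : ℝ) ^ (Λ * (cm * n + 1)) := Real.rpow_lt_rpow_of_exponent_lt hq1 hexp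
      _ = ((q : ℝ) ^ (cm * n + 1)) ^ Λ := by rw [mul_comm, Real.rpow_mul hq0.le]
      _ ≤ (r * q) ^ Λ := Real.rpow_le_rpow hpos.le hlow1 hΛ0.le
      _ = ((rad 1 (q ^ n - 1) (q ^ n) : ℕ) : ℝ) ^ Λ := by rw [hradT]
  -- the drought property at `R` bounds `c = q^n` by `rad^{1+δ}`
  have hc := hgood 1 (q ^ n - 1) (q ^ n) htri hradRn hwin
  have hc' : (q : ℝ) ^ (n : ℝ) ≤ (r * q) ^ (1 + δ) := by
    have : ((q ^ n : ℕ) : ℝ) = (q : ℝ) ^ (n : ℝ) := by push_cast; rw [Real.rpow_natCast]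
    rw [← this, ← hradT]; exact hc
  -- but `(r q)^{1+δ} ≤ q^{(1+δ)(cp n + 1)} < q^n`
  have hδ0 : 0 < 1 + δ := by rw [hδ]; linarith
  have hkey : (1 + δ) * (cp * n + 1) < n := by
    have hun : 4 < u * n := by
      have h1 : 4 / u < n := lt_of_lt_of_le hn₁ (by exact_mod_cast hn1')
      rw [div_lt_iff₀ hu0] at h1
      linarith
    have hu2n : 0 ≤ u ^ 2 * n := by positivity
    have hcpu : cp ≤ 1 - 7 * u / 8 := by
      have h' := hcpε₁
      rw [hε₁] at h'
      linarith
    have hδpos : 0 ≤ 1 + δ := hδ0.le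
    have hprod : (1 + δ) * (cp * n) ≤ (1 + δ) * ((1 - 7 * u / 8) * n) :=
      mul_le_mul_of_nonneg_left (mul_le_mul_of_nonneg_right hcpu hnR) hδpos
    have h1 : (1 + δ) * (cp * n + 1) ≤ (1 + δ) * ((1 - 7 * u / 8) * n) + (1 + δ) := by
      linarith
    have h2 : (1 + δ) * ((1 - 7 * u / 8) * n) + (1 + δ) < n := by
      rw [hδ]
      linarith
    linarith
  have hlt : (r * q) ^ (1 + δ) < (q : ℝ) ^ (n : ℝ) :=
    calc (r * q) ^ (1 + δ) ≤ ((q : ℝ) ^ (cp * n + 1)) ^ (1 + δ) :=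
          Real.rpow_le_rpow (mul_nonneg hr0.le hq0.le) hup1 hδ0.le
      _ = (q : ℝ) ^ ((1 + δ) * (cp * n + 1)) := by rw [mul_comm (1 + δ), Real.rpow_mul hq0.le]
      _ < (q : ℝ) ^ (n : ℝ) := Real.rpow_lt_rpow_of_exponent_lt hq1 hkey
  linarith

/-- **DA∃ excludes every intermediate growth law for the radical of `q^n − 1`.**  The horizontal
stub DA∃ of line `SketchIdeator4` (hypothesis = the registered signature of
`stub_droughtsOfSomeRatio` verbatim) implies that for every prime `q` and every `γ ∈ (0,1)` it is
NOT the case that `q^{(γ−ε)n} ≤ rad(q^n − 1) ≤ q^{(γ+ε)n}` for every `ε > 0` and all large `n` —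
i.e. `log rad(q^n − 1)/(n log q)` does not converge to any `γ ∈ (0,1)`.  abc gives rate `1`; no
rate in `(0,1)` is excluded unconditionally (that needs `rad(q^n − 1) ≥ q^{(γ+ε)n}` infinitely
often), so this is a standalone open-problem floor for the stub.  (The statement is kept on one
line: it is the signature registered on stmt-ABC-2161 for this sub-goal.) [folklore] -/
theorem sparseGoodScales_droughts_imp_no_intermediate_radical_rate : (∀ δ : ℝ, 0 < δ → ∃ Λ : ℝ, 1 < Λ ∧ ∀ N : ℕ, ∃ R : ℕ, N ≤ R ∧ ∀ a b c : ℕ, Literature.NumberTheory.DiophantineGeometry.IsABCTriple a b c → Literature.NumberTheory.DiophantineGeometry.rad a b c ≤ R → (R : ℝ) < ((Literature.NumberTheory.DiophantineGeometry.rad a b c : ℕ) : ℝ) ^ Λ → (c : ℝ) ≤ ((Literature.NumberTheory.DiophantineGeometry.rad a b c : ℕ) : ℝ) ^ (1 + δ)) → ∀ q : ℕ, q.Prime → ∀ γ : ℝ, 0 < γ → γ < 1 → ¬ (∀ ε : ℝ, 0 < ε → ∃ n₀ : ℕ, ∀ n : ℕ, n₀ ≤ n → (q : ℝ) ^ ((γ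 - ε) * n) ≤ ((UniqueFactorizationMonoid.radical (q ^ n - 1) : ℕ) : ℝ) ∧ ((UniqueFactorizationMonoid.radical (q ^ n - 1) : ℕ) : ℝ) ≤ (q : ℝ) ^ ((γ + ε) * n)) := by
  intro hD q hq γ hγ0 hγ1 hH
  have hδ0 : (0 : ℝ) < (1 - γ) / 2 := by linarith
  obtain ⟨Λ, hΛ, hdr⟩ := hD ((1 - γ) / 2) hδ0
  exact sparseGoodScales_droughts_false_of_radical_rate hq hγ0 hγ1 hH hΛ hdr

end Summit.ABC.ABC.Theorems

end
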